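import Summits.HodgeConjecture.HodgeConjecture.Theses.PadicSemiregularLift
import Summits.HodgeConjecture.HodgeConjecture.Theorems.PadicSemiregularLiftHodgeAbelianVarietiesStubVhcFromCMFibre
import Summits.HodgeConjecture.HodgeConjecture.Theorems.PadicSemiregularLiftHodgeAbelianVarietiesStubCmAnchoredFamilies
import Literature.AlgebraicGeometry.HodgeTheory.AlgebraicityLocusIUnionClosedProofs

/-!
# Crux `HodgeAbelianVarieties` (stmt-HodgeConjecture-1333) — the CM PIVOT: sorry-free GLUE of the decomposition `HodgeAbelianVarieties ⇐ HodgeCM ∧ CMAnchoredFamilies ∧ LocalVHCAtCM`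

Route `PadicSemiregularLift`, crux r4 `HodgeAbelianVarieties := ∀ A : AbelianVariety ℂ, HodgeConjectureFor A.dim A.X`
(= the Hodge conjecture for every complex abelian variety). This file is the Theorems-side landing
(lead prover-line-stmt-HodgeConjecture-1333-c6-0, line `cm-pivot`, `--supports stmt-HodgeConjecture-1333`)
of the crux strategist's GLUE (`Cruxes/HodgeAbelianVarieties/Lines/cm_pivot.lean`, planner
planner-cstrat-stmt-HodgeConjecture-1333-p1-0, 2026-08-17; `STRATEGY-CENSUS.md` §Decomposition D4), verbatim
up to the namespace, so that a planner's final-cycle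
`route edit route-HodgeConjecture-PadicSemiregularLift --split HodgeAbelianVarieties --into children.json
 --glue-by Summit.HodgeConjecture.HodgeConjecture.Theorems.HodgeAbelianVarieties.CMPivot.hodgeAbelianVarieties_of_cmPivot`
is one command. No stub, no `sorry`, no new definition (the three children are LOCAL NOTATIONS, byte-identical
with the registered stubs `stub_hodgeCM` / `stub_cmAnchoredFamilies` / `stub_localVHCAtCM` of the skeleton and
with `children.json` on the item).

## The three statements (children)

* `HodgeCM[]` — HC for complex abelian varieties of CM type (`IsCM[A]`: an endomorphism with `2 · dim A`
  distinct eigenvalues on `H¹(A(ℂ); ℂ)`).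
* `CMAnchoredFamilies[]` — CM-anchored Mumford–Tate packaging of every rational `(p,p)` class: `(A, c)` is the
  value at a fibre of a global class `G` on a smooth projective family over a smooth irreducible quasi-projective
  base, rational `(p,p)` on every fibre presented as an abelian variety, with a CM fibre (print theorem:
  Cattani–Deligne–Kaplan 1995 + Deligne 1982 + Mumford 1969 + theorem of the fixed part).
* `LocalVHCAtCM[]` — local variational Hodge at a CM fibre: algebraic on the CM fibre ⟹ algebraic on the fibres
  over a Euclidean neighbourhood.

`IsQuasiProjectiveOver` is INLINED and `≫` spelled `CategoryStruct.comp` so that the statements elaborate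
verbatim in the route file's context.

## What is proved (all sorry-free)

* `vhcAlongBase_of_localVHCAtCM` — child 3 ⟹ transport along the whole base (the gallery worker's reduction
  `Stubs.stub_vhcFromCMFibre_of_openNearCM`, p92924, fed with the tree's THEOREM
  `charlesSchnell_algebraicityLocus_iUnion_closed_holds`).
* `hodgeAbelianVarieties_of_cmPivot` — **the three children imply the crux** (Hodge models exist for abelian
  varieties: `Stubs.cmFamilies_nonempty_hodgeModel`; child 2 packages `(A, c)`; child 1 gives algebraicity on
  the CM fibre; child 3 + the first theorem transport it to `A`).
* `hodgeCM_of_hodgeAbelianVarieties`, `localVHCAtCM_of_hodgeAbelianVarieties` — upper bounds: children 1 and 3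
  follow from the crux (child 3 given the printed "all fibres are abelian varieties", GIT Thm. 6.14, as an
  inlined hypothesis), so no child claims more than the summit.

HONEST STATUS (strategist, confirmed by this seat): modulo child 2 (print) and two printed theorems, child 3
is EQUIVALENT to HC for the non-CM fibres (`Stubs.vhcFromCMProj_iff_openNearCM`) and child 1 is HC(CM): the
split is the partition "CM existence problem ∣ transport problem" (Deligne 1982 / André 1992 /
Bloch–Esnault–Kerz 2014), each half with its own literature; neither half is the crux. Child 1 is, up to the
typing of "CM", the existing shared item `CMAbelianHodge` (stmt-HodgeConjecture-3052, routes
SupersingularIsotypicLift / RankFourFaces), and children 2 ∧ 3 carry the content of `RankFourFaces.CMToAbelian`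
(stmt-HodgeConjecture-16267); the kernel-checked bridges between the two CM typings are the business of the
companion file `…CMPivotBridge` (this seat).
-/

set_option linter.dupNamespace false

noncomputable section

open CategoryTheory
open Literature.AlgebraicGeometry Literature.AlgebraicGeometry.Motives

namespace Summit.HodgeConjecture.HodgeConjecture.Theorems.HodgeAbelianVarieties.CMPivot

/-! ### The three sub-crux statements (verbatim the children to be installed in the route file) -/

/-- `IsCM[A]` — CM type: an endomorphism with `2 · dim A` distinct eigenvalues on `H¹(A(ℂ); ℂ)`
(verbatim the gallery line's notation). Local notation only. -/
local notation3 (prettyPrint := false) "IsCM[" A "]" =>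
  ∃ (ψ : A ⟶ A) (μ : Fin (2 * AbelianVariety.dim A) → ℂ), Function.Injective μ ∧
    ∀ i, Module.End.HasEigenvalue (HodgeTheory.complexBetti.map ψ.hom.hom.hom 1).hom (μ i)

/-- `QProj[X]` — `X` is quasi-projective over `ℂ`: INLINED body of
`HodgeTheory.IsQuasiProjectiveOver X` (the route file does not import its home module). Local notation only. -/
local notation3 (prettyPrint := false) "QProj[" X "]" =>
  ∃ (P : SchemeOver ℂ) (j : X ⟶ P), IsProjectiveOver P ∧ AlgebraicGeometry.IsOpenImmersion j.left

/-- `FibreIncl[f, B, e, s]` — `e` presents `B` as THE fibre of `f` over `s` (`≫` spelled out). Local notation only. -/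
local notation3 (prettyPrint := false) "FibreIncl[" f ", " B ", " e ", " s "]" =>
  ∃ i : AbelianVariety.X B ≅ fiberOver f s, e = CategoryStruct.comp i.hom (fiberι f s)

/-- `HodgeAlong[S, 𝒳, f, G, p]` — `G` is rational `(p,p)` on every fibre presented as an abelian variety. Local notation only. -/
local notation3 (prettyPrint := false) "HodgeAlong[" S ", " 𝒳 ", " f ", " G ", " p "]" =>
  ∀ (B : AbelianVariety ℂ) (eB : AbelianVariety.X B ⟶ 𝒳) (u : ComplexPoints S),
    FibreIncl[f, B, eB, u] →
      HodgeTheory.IsRationalClass (HodgeTheory.complexBetti.map eB (2 * p) G) ∧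
      HodgeTheory.IsOfHodgeType B.dim B.X (2 * p) p p (HodgeTheory.complexBetti.map eB (2 * p) G)

/-- CHILD 1 `HodgeCM[]` — the Hodge conjecture for complex abelian varieties of CM type. Local notation only. -/
local notation3 (prettyPrint := false) "HodgeCM[]" =>
  ∀ A : AbelianVariety ℂ, IsCM[A] → HodgeTheory.HodgeConjectureFor A.dim A.X

/-- CHILD 2 `CMAnchoredFamilies[]` — CM-anchored Mumford–Tate packaging of every rational `(p,p)` class
(the gallery line's `CMFamilies[]` clause (b), gen 3, with the total space quasi-projective; clause (a)
"Hodge models exist" dropped, being the theorem `Stubs.cmFamilies_nonempty_hodgeModel`). Local notation only. -/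
local notation3 (prettyPrint := false) "CMAnchoredFamilies[]" =>
  ∀ (A : AbelianVariety ℂ) (p : ℕ) (c : HodgeTheory.complexBetti A.X (2 * p)),
    HodgeTheory.IsRationalClass c → HodgeTheory.IsOfHodgeType A.dim A.X (2 * p) p p c →
    ∃ (S 𝒳 : SchemeOver ℂ) (f : 𝒳 ⟶ S) (G : HodgeTheory.complexBetti 𝒳 (2 * p))
      (t s₀ : ComplexPoints S) (e : A.X ⟶ 𝒳) (A₀ : AbelianVariety ℂ) (e₀ : A₀.X ⟶ 𝒳),
      QProj[𝒳] ∧ QProj[S] ∧ AlgebraicGeometry.Smooth S.hom ∧ IrreducibleSpace S.left ∧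
      IsSmoothProjectiveFamily f A.dim ∧
      FibreIncl[f, A, e, t] ∧ FibreIncl[f, A₀, e₀, s₀] ∧ IsCM[A₀] ∧
      HodgeTheory.complexBetti.map e (2 * p) G = c ∧ HodgeAlong[S, 𝒳, f, G, p]

/-- CHILD 3 `LocalVHCAtCM[]` — local variational Hodge at a CM fibre (= the gallery line's germ
`OpenNearCM[]`, worker file p92924, with `IsQuasiProjectiveOver` inlined). Local notation only. -/
local notation3 (prettyPrint := false) "LocalVHCAtCM[]" =>
  ∀ (S 𝒳 : SchemeOver ℂ) (f : 𝒳 ⟶ S) (m p : ℕ) (G : HodgeTheory.complexBetti 𝒳 (2 * p))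
    (s₀ : ComplexPoints S) (A₀ : AbelianVariety ℂ) (e₀ : A₀.X ⟶ 𝒳),
    QProj[𝒳] → QProj[S] → AlgebraicGeometry.Smooth S.hom → IrreducibleSpace S.left →
    IsSmoothProjectiveFamily f m →
    FibreIncl[f, A₀, e₀, s₀] → IsCM[A₀] →
    HodgeTheory.complexBetti.map e₀ (2 * p) G ∈ HodgeTheory.algebraicClasses A₀.X p →
    HodgeAlong[S, 𝒳, f, G, p] →
    ∃ U : Set (ComplexPoints S), IsOpen U ∧ s₀ ∈ U ∧ ∀ t ∈ U,
      HodgeTheory.complexBetti.map (fiberι f t) (2 * p) G ∈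
        HodgeTheory.algebraicClasses (fiberOver f t) p

/-! ### The glue -/

/-- **Child 3 ⟹ the transport along the whole base** (the gallery worker's reduction
`Stubs.stub_vhcFromCMFibre_of_openNearCM`, p92924, fed with the tree's THEOREM
`charlesSchnell_algebraicityLocus_iUnion_closed_holds`; `IsQuasiProjectiveOver` unfolds by `Iff.rfl`):
for a CM-anchored family as above, algebraicity of `G` on the CM fibre propagates to every abelian
fibre. [cite: CharlesSchnell2014Notes, Prop. 11.3.11 (proof)] [cite: VoisinHodgeII2003, §7.3.2, proof of Thm. 7.19] -/
theorem vhcAlongBase_of_localVHCAtCM (hopen : LocalVHCAtCM[]) :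
    ∀ (S 𝒳 : SchemeOver ℂ) (f : 𝒳 ⟶ S) (m p : ℕ) (G : HodgeTheory.complexBetti 𝒳 (2 * p))
      (s₀ : ComplexPoints S) (A₀ : AbelianVariety ℂ) (e₀ : A₀.X ⟶ 𝒳),
      QProj[𝒳] → QProj[S] → AlgebraicGeometry.Smooth S.hom → IrreducibleSpace S.left →
      IsSmoothProjectiveFamily f m →
      FibreIncl[f, A₀, e₀, s₀] → IsCM[A₀] →
      HodgeTheory.complexBetti.map e₀ (2 * p) G ∈ HodgeTheory.algebraicClasses A₀.X p →
      HodgeAlong[S, 𝒳, f, G, p] →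
      ∀ (B : AbelianVariety ℂ) (eB : B.X ⟶ 𝒳) (u : ComplexPoints S), FibreIncl[f, B, eB, u] →
        HodgeTheory.complexBetti.map eB (2 * p) G ∈ HodgeTheory.algebraicClasses B.X p :=
  Summit.HodgeConjecture.HodgeConjecture.Cruxes.HodgeAbelianVarieties.SubtorusGalleryBlochSeeds.Stubs.stub_vhcFromCMFibre_of_openNearCM
    HodgeTheory.charlesSchnell_algebraicityLocus_iUnion_closed_holds hopen

/-- **THE CM PIVOT — the three sub-cruxes imply the crux** (sorry-free glue of the decomposition
`HodgeAbelianVarieties ⇐ HodgeCM ∧ CMAnchoredFamilies ∧ LocalVHCAtCM`): given `A`, a Hodge model exists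
(`Stubs.cmFamilies_nonempty_hodgeModel`, a theorem); given a rational `(p,p)` class `c`, child 2
packages `(A, c)` into a CM-anchored family with global class `G` (`G|_A = c`), child 1 gives HC on the
CM fibre `A₀`, so `G|_{A₀}` is algebraic, child 3 + `vhcAlongBase_of_localVHCAtCM` transport
algebraicity to the fibre `A`. [folklore assembly] [cite: BlochEsnaultKerz2014CharZero, appendix ("the variational Hodge conjecture for abelian schemes implies the Hodge conjecture for abelian varieties")] [cite: Andre1992CMHodge, §1] -/
theorem hodgeAbelianVarieties_of_cmPivot :
    HodgeCM[] → CMAnchoredFamilies[] → LocalVHCAtCM[] →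
      Summit.HodgeConjecture.HodgeConjecture.Theses.PadicSemiregularLift.HodgeAbelianVarieties := by
  intro hcm hfam hopen
  have h₅ := vhcAlongBase_of_localVHCAtCM hopen
  intro A
  refine ⟨Summit.HodgeConjecture.HodgeConjecture.Cruxes.HodgeAbelianVarieties.SubtorusGalleryBlochSeeds.Stubs.cmFamilies_nonempty_hodgeModel A, fun p c hc hh => ?_⟩
  obtain ⟨S, 𝒳, f, G, t, s₀, e, A₀, e₀, h𝒳, hqp, hsm, hirr, hfamily, hAt, hA₀, hCM, hGc, hHodge⟩ :=
    hfam A p c hc hh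
  have h₀ := hHodge A₀ e₀ s₀ hA₀
  have halg₀ : HodgeTheory.complexBetti.map e₀ (2 * p) G ∈ HodgeTheory.algebraicClasses A₀.X p :=
    (hcm A₀ hCM).2 p _ h₀.1 h₀.2
  have hA := h₅ S 𝒳 f A.dim p G s₀ A₀ e₀ h𝒳 hqp hsm hirr hfamily hA₀ hCM halg₀ hHodge A e t hAt
  rw [hGc] at hA
  exact hA

/-! ### Sanity: the split is below the crux (children 1 and 3 are consequences of it) -/

/-- Child 1 is an instance of the crux (restriction to CM abelian varieties). [folklore] -/
theorem hodgeCM_of_hodgeAbelianVarieties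
    (h : Summit.HodgeConjecture.HodgeConjecture.Theses.PadicSemiregularLift.HodgeAbelianVarieties) :
    HodgeCM[] :=
  fun A _ => h A

/-- Child 3 follows from the crux on every family all of whose complex fibres are presented by
abelian varieties (the printed hypothesis `AbelianFibres[]` of the gallery worker file, GIT
Thm. 6.14, taken here as a hypothesis in its inlined form): at each `t` apply the crux to a presentation
`B ≅ 𝒳_t` and move algebraicity back to THE fibre (`Stubs.map_mem_algebraicClasses_iff_of_fibreIncl`).
So no child claims more than the summit. [cite: MumfordFogartyKirwan1994, Ch. 6 §1 Thm. 6.14] -/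
theorem localVHCAtCM_of_hodgeAbelianVarieties
    (h : Summit.HodgeConjecture.HodgeConjecture.Theses.PadicSemiregularLift.HodgeAbelianVarieties)
    (hAV : ∀ (S 𝒳 : SchemeOver ℂ) (f : 𝒳 ⟶ S) (m : ℕ) (s₀ : ComplexPoints S) (A₀ : AbelianVariety ℂ)
      (e₀ : A₀.X ⟶ 𝒳), QProj[𝒳] → QProj[S] → AlgebraicGeometry.Smooth S.hom → IrreducibleSpace S.left →
      IsSmoothProjectiveFamily f m → FibreIncl[f, A₀, e₀, s₀] →
      ∀ t : ComplexPoints S, ∃ (B : AbelianVariety ℂ) (eB : B.X ⟶ 𝒳), FibreIncl[f, B, eB, t]) :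
    LocalVHCAtCM[] := by
  intro S 𝒳 f m p G s₀ A₀ e₀ h𝒳 hS hSsm hirr hf hA₀ _ _ hHodge
  refine ⟨Set.univ, isOpen_univ, Set.mem_univ _, fun t _ => ?_⟩
  obtain ⟨B, eB, hB⟩ := hAV S 𝒳 f m s₀ A₀ e₀ h𝒳 hS hSsm hirr hf hA₀ t
  have hBt := hHodge B eB t hB
  have hdim : B.dim = m :=
    Summit.HodgeConjecture.HodgeConjecture.Cruxes.HodgeAbelianVarieties.SubtorusGalleryBlochSeeds.Stubs.dim_eq_of_fibreIncl hf hB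
  have hBalg : HodgeTheory.complexBetti.map eB (2 * p) G ∈ HodgeTheory.algebraicClasses B.X p :=
    (h B).2 p _ hBt.1 hBt.2
  exact (Summit.HodgeConjecture.HodgeConjecture.Cruxes.HodgeAbelianVarieties.SubtorusGalleryBlochSeeds.Stubs.map_mem_algebraicClasses_iff_of_fibreIncl hf hB p G).1 hBalg

end Summit.HodgeConjecture.HodgeConjecture.Theorems.HodgeAbelianVarieties.CMPivot

end
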